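import Mathlib
import HarnessLib
import Literature.MathematicalPhysics.StatisticalMechanics.WeightTheoremABKM

/-!
# Theorem 7.1 (w1)–(w7) for the weight tower built from a GIVEN finite-range decomposition package
# ([ABKM19] Theorem 7.1, the `q`-layer bookkeeping: weights and step kernels from ONE package)

`WeightTheoremABKM.exists_abkm_weight_bounds` obtains the finite-range decomposition from
`GradientFRD.TorusFRD_holds` INSIDE its proof and returns the `A = 1` kernels existentially, so the
`q`-dependent kernels `𝒞_{1+q,k}` of the same decomposition (needed for the steps `T_k^{(q)}` of
[ABKM19] Ch. 12, compared with the weights' kernels by `TorusFRDKernelComparison`) are not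
accessible afterwards.  This file proves the same conclusion for a package GIVEN as hypotheses
(the data `𝒞f, Mc, Cα, c, C, Cℓ`, `c > 0`, and the clauses (o)–(v) of `TorusFRD d` at `ω₀ = ½`,
`Ω₀ = 2`, verbatim), with the EXPLICIT integration constant
`A_𝒫 = weightIntConst θ̄ (traceConst d M_ord R λ (derivSum d n C))`:

* **`abkm_weight_bounds_of_package`**.

Everything is proved (the proof is that of `exists_abkm_weight_bounds` minus its first line); no named fact.

## References
* S. Adams, S. Buchholz, R. Kotecký, S. Müller, arXiv:1910.13564, Theorem 7.1, Lemmas 7.3–7.7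
  [AdamsBuchholzKoteckyMuller2019].
* S. Buchholz, J. Funct. Anal. 275 (2018), Thm 2.4 [Buchholz2016].
-/

noncomputable section

namespace Literature.MathematicalPhysics.StatisticalMechanics.GradientRG

open Finset Matrix Real MeasureTheory ProbabilityTheory WithLp
open scoped MatrixOrder
open Literature.MathematicalPhysics.StatisticalMechanics.GradientFRD
  (iterDiff supNorm mulMat fourierCoeff cExt InShell ShellBoundsV symbR conv ellOp TorusFRD_holds
    isElliptic_one exists_shell_and_bounds sum_cExt_mul_symbR_eq_one cExt_fourierCoeff_neg
    cExt_fourierCoeff_zero_mode cExt_nonneg IsUnitSymm IsElliptic)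
open Literature.MathematicalPhysics.StatisticalMechanics.TorusPolymer
  (thicken Separated IsPolymer numBlocks)

variable {d : ℕ}

/-- **[ABKM19] Theorem 7.1 (w1)–(w7) for the weight tower built from a GIVEN finite-range
decomposition package** (the data `𝒞f, Mc, Cα, c, C, Cℓ` and clauses (o)–(v) of `GradientFRD.TorusFRD d`
at `ω₀ = ½`, `Ω₀ = 2`, as produced by ONE `obtain` from `TorusFRD_holds d`): the same conclusion as
`exists_abkm_weight_bounds`, for the kernels `𝒞f L N M 1` of the package — so that the q-dependent step
kernels `𝒞f L N M (1+q)` of the SAME package can be compared with the weights' kernels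
(`TorusFRDKernelComparison`). [cite: AdamsBuchholzKoteckyMuller2019, Theorem 7.1] -/
theorem abkm_weight_bounds_of_package (hd : 3 ≤ d) {Mord R : ℕ} (hMord : 2 ≤ Mord) (hMR : Mord ≤ R)
    {n ñ : ℕ} (hn : 2 * Mord ≤ n) {θbar lam : ℝ} (hθ0 : 0 < θbar)
    (hθ1 : θbar ≤ 1 / 4) (hlam : 0 < lam) (hT : 2 * θbar + lam < 1)
    {𝒞f : (L N M : ℕ) → Matrix (Fin d) (Fin d) ℝ → ℕ → (Fin d → ZMod M) → ℝ}
    {Mc : ℕ → ℕ → ℕ → ℝ} {Cα : (Fin d → ℕ) → ℕ → ℝ} {c C : ℝ} {Cℓ : ℕ → ℝ} (hc : 0 < c)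
    (hall : ∀ L : ℕ, Odd L → 3 < L → ∀ N : ℕ, 1 ≤ N → ∀ (M : ℕ) [NeZero M], M = L ^ N →
          ∀ A : Matrix (Fin d) (Fin d) ℝ, IsElliptic (1 / 2 : ℝ) 2 A →
            (∀ k, 1 ≤ k → k ≤ N + 1 →
              ∑ x : Fin d → ZMod M, 𝒞f L N M A k x = 0 ∧ ∀ x, 𝒞f L N M A k (-x) = 𝒞f L N M A k x) ∧
            (∀ k, 1 ≤ k → k ≤ N + 1 → ∀ φ : (Fin d → ZMod M) → ℝ, ∑ x, φ x = 0 →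
              0 ≤ ∑ x, ∑ y, φ x * 𝒞f L N M A k (x - y) * φ y) ∧
            (∀ φ : (Fin d → ZMod M) → ℝ, ∑ x, φ x = 0 →
              ellOp A (conv (fun x => ∑ k ∈ Finset.Icc 1 (N + 1), 𝒞f L N M A k x) φ) = φ) ∧
            (∀ k, 1 ≤ k → k ≤ N → Mc L N k ≤ 0 ∧
              ∀ x : Fin d → ZMod M, ((L : ℝ) ^ k) / 2 ≤ (supNorm x : ℝ) →
                𝒞f L N M A k x = Mc L N k) ∧
            (∀ k, 1 ≤ k → k ≤ N + 1 → ∀ B : Matrix (Fin d) (Fin d) ℝ, IsUnitSymm B →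
              (∃ ε : ℝ, 0 < ε ∧ ∀ x : Fin d → ZMod M,
                ContDiffOn ℝ ⊤ (fun s : ℝ => 𝒞f L N M (A + s • B) k x) (Set.Ioo (-ε) ε)) ∧
              ∀ α : Fin d → ℕ, ∑ i, α i ≤ n → ∀ ℓ : ℕ, ∀ x : Fin d → ZMod M,
                abs (iteratedDeriv ℓ (fun s : ℝ => iterDiff α (𝒞f L N M (A + s • B) k) x) 0)
                  ≤ Cα α ℓ / (L : ℝ) ^ ((k - 1) * (d - 2 + ∑ i, α i))) ∧
            (∀ k, 1 ≤ k → k ≤ N + 1 → ∀ j : ℕ, ∀ κ : Fin d → ZMod M, κ ≠ 0 → InShell L j κ →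
              (j < k →
                c / (L : ℝ) ^ (2 * (d + ñ) + 1) * (L : ℝ) ^ (2 * j)
                    / (L : ℝ) ^ ((k - j) * (d - 1 + n)) ≤ (fourierCoeff (𝒞f L N M A k) κ).re ∧
                ‖fourierCoeff (𝒞f L N M A k) κ‖
                  ≤ C * (L : ℝ) ^ (2 * (d + ñ) + 1) * (L : ℝ) ^ (2 * j)
                      / (L : ℝ) ^ ((k - j) * (d - 1 + n))) ∧
              (k ≤ j →
                c / (L : ℝ) ^ (2 * (d + ñ) + 1) * (L : ℝ) ^ (2 * k)
                    ≤ (fourierCoeff (𝒞f L N M A k) κ).re ∧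
                ‖fourierCoeff (𝒞f L N M A k) κ‖ ≤ C * (L : ℝ) ^ (2 * k)) ∧
              ∀ B : Matrix (Fin d) (Fin d) ℝ, IsUnitSymm B → ∀ ℓ : ℕ, 1 ≤ ℓ →
                (j < k →
                  ‖iteratedDeriv ℓ (fun s : ℝ => fourierCoeff (𝒞f L N M (A + s • B) k) κ) 0‖
                    ≤ Cℓ ℓ * (L : ℝ) ^ (2 * (d + ñ) + 1) * (L : ℝ) ^ (2 * j)
                        / (L : ℝ) ^ ((k - j) * (d - 1 + ñ))) ∧
                (k ≤ j →
                  ‖iteratedDeriv ℓ (fun s : ℝ => fourierCoeff (𝒞f L N M (A + s • B) k) κ) 0‖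
                    ≤ Cℓ ℓ * (L : ℝ) ^ (2 * k)))) :
    ∀ L : ℕ, Odd L → 2 ^ (d + 3) + 16 * R ≤ L →
      ∃ (μ δ₁ δ₀ : ℝ), 0 ≤ μ ∧ 0 < δ₁ ∧ 0 < δ₀ ∧
        ∀ N : ℕ, 1 ≤ N → ∀ (M : ℕ) [NeZero M], M = L ^ N →
          AbkmWeightBounds L N Mord R n θbar lam μ δ₁ δ₀
            (weightIntConst θbar (traceConst d Mord R lam (derivSum d n fun θ' _ => Cα θ' 0)))
            (fun j => 𝒞f L N M 1 j)
            (abkmWeightData L N Mord R θbar (schedDelta δ₀ δ₁ N) fun j => 𝒞f L N M 1 j) := by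
  set s := diffIndex d Mord with hsdef
  have hsM : ∀ α ∈ s, ∑ i, α i ≤ Mord := fun α hα => (mem_diffIndex.1 hα).2
  have hd1 : 1 ≤ d := by omega
  have hd2 : 2 ≤ d := by omega
  have hMord1 : 1 ≤ Mord := by omega
  have hR2 : 2 ≤ R := hMord.trans hMR
  set A := weightIntConst θbar (traceConst d Mord R lam (derivSum d n fun θ' _ => Cα θ' 0)) with hA
  intro L hLodd hL
  -- size of `L`
  have hL64 : 2 ^ 6 ≤ 2 ^ (d + 3) := Nat.pow_le_pow_right (by norm_num) (by omega)
  have hL5 : 5 ≤ L := by omega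
  have hL3 : 3 < L := by omega
  have hL1r : (1 : ℝ) < L := by exact_mod_cast (show 1 < L by omega)
  have hLM : Mord ≤ L := by omega
  have h3L : 2 ^ d + 3 * R ≤ 3 * L := by
    have : 2 ^ d ≤ 2 ^ (d + 3) := Nat.pow_le_pow_right (by norm_num) (by omega); omega
  -- the `N`-independent schedule at this `L` (with `ω₀ = 1`, `C ↦ max C 0`)
  have hn' : 2 * (Mord - 1) < d - 1 + n := by omega
  obtain ⟨k₀, μ, δ₁, hμ0, hδ₁, hμδ, hδlam, hsmall, hlarge⟩ :=
    exists_schedule_core (s := s) hsM hL1r hd1 (ñ := ñ) hn' hlam hc (le_max_right C 0)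
      one_pos hθ0
  set K : ℝ := ∑ α ∈ s, ((4 : ℝ) * d) ^ (∑ i, α i - 1) with hK
  obtain ⟨δ₀, hδ₀, hseed⟩ := exists_delta0 (T := 1 + 2 * θbar + lam) (K := K) (by linarith)
    (by linarith) (Finset.sum_nonneg fun _ _ => by positivity)
  refine ⟨μ, δ₁, δ₀, hμ0, hδ₁, hδ₀, ?_⟩
  intro N hN M _ hM
  obtain ⟨ho, hi, hii, hiii, hiv, hv⟩ := hall L hLodd hL3 N hN M hM 1 isElliptic_one
  -- derived kernel facts
  have ho' : ∀ k ∈ Icc 1 (N + 1), ∑ x : Fin d → ZMod M, 𝒞f L N M 1 k x = 0 ∧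
      ∀ x, 𝒞f L N M 1 k (-x) = 𝒞f L N M 1 k x := fun k hk => by
    rw [mem_Icc] at hk; exact ho k hk.1 hk.2
  have hLr0 : (0 : ℝ) ≤ (L : ℝ) := by positivity
  have hv' : ∀ k, 1 ≤ k → k ≤ N + 1 → ∀ j : ℕ, ∀ κ : Fin d → ZMod M, κ ≠ 0 → InShell L j κ →
      (j < k →
        c / (L : ℝ) ^ (2 * (d + ñ) + 1) * (L : ℝ) ^ (2 * j) / (L : ℝ) ^ ((k - j) * (d - 1 + n)) ≤
            (fourierCoeff (𝒞f L N M 1 k) κ).re ∧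
          ‖fourierCoeff (𝒞f L N M 1 k) κ‖ ≤
            max C 0 * (L : ℝ) ^ (2 * (d + ñ) + 1) * (L : ℝ) ^ (2 * j) / (L : ℝ) ^ ((k - j) * (d - 1 + n))) ∧
      (k ≤ j →
        c / (L : ℝ) ^ (2 * (d + ñ) + 1) * (L : ℝ) ^ (2 * k) ≤ (fourierCoeff (𝒞f L N M 1 k) κ).re ∧
          ‖fourierCoeff (𝒞f L N M 1 k) κ‖ ≤ max C 0 * (L : ℝ) ^ (2 * k)) := by
    intro k hk1 hkN j κ hκ hj
    obtain ⟨h1, h2, -⟩ := hv k hk1 hkN j κ hκ hj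
    refine ⟨fun hjk => ⟨(h1 hjk).1, (h1 hjk).2.trans ?_⟩, fun hkj => ⟨(h2 hkj).1, (h2 hkj).2.trans ?_⟩⟩
    · exact div_le_div_of_nonneg_right (mul_le_mul_of_nonneg_right
        (mul_le_mul_of_nonneg_right (le_max_left _ _) (by positivity)) (by positivity)) (by positivity)
    · exact mul_le_mul_of_nonneg_right (le_max_left _ _) (by positivity)
  have hshell := fun κ hκ => exists_shell_and_bounds (d := d) (n := n) (ñ := ñ) hL5 hM hv' κ hκ
  have heven : ∀ k ∈ Icc 1 (N + 1), ∀ x, 𝒞f L N M 1 k (-x) = 𝒞f L N M 1 k x :=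
    fun k hk => (ho' k hk).2
  have hinv := fun κ (hκ : κ ≠ 0) => sum_cExt_mul_symbR_eq_one Matrix.isSymm_one heven hii hκ
  have hf_even := fun κ j => cExt_fourierCoeff_neg (N := N) heven κ j
  have hf_zero := fun j => cExt_fourierCoeff_zero_mode (N := N) (fun k hk => (ho' k hk).1) j
  have hnn : ∀ (j : ℕ) (κ : Fin d → ZMod M),
      0 ≤ cExt N (fun j => fourierCoeff (𝒞f L N M 1 j) κ) j := by
    intro j κ
    by_cases hκ : κ = 0
    · rw [hκ, hf_zero]
    · obtain ⟨j', -, -, hsb⟩ := hshell κ hκ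
      exact cExt_nonneg hsb hc.le hLr0 j
  have hfr : ∀ j, 1 ≤ j → j ≤ N → ∃ c' : ℝ, ∀ x : Fin d → ZMod M,
      ((L : ℝ) ^ j) / 2 ≤ (supNorm x : ℝ) → 𝒞f L N M 1 j x = c' :=
    fun j hj1 hjN => ⟨Mc L N j, (hiii j hj1 hjN).2⟩
  have hreg : ∀ j, 1 ≤ j → j ≤ N + 1 → ∀ θ' : Fin d → ℕ, ∑ i, θ' i ≤ n → ∀ x,
      |iterDiff θ' (𝒞f L N M 1 j) x| ≤ Cα θ' 0 / (L : ℝ) ^ ((j - 1) * (d - 2 + ∑ i, θ' i)) := by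
    intro j hj1 hjN θ' hθ' x
    obtain ⟨-, hb⟩ := hiv j hj1 hjN 0 isUnitSymm_zero
    have := hb θ' hθ' 0 x
    rw [iteratedDeriv_zero] at this
    simpa only [smul_zero, add_zero] using this
  -- the schedule at this `N`
  obtain ⟨hθrec, hθlo, hθhi2, hθhi1, hδnn, hδ4, hμδ', hδN⟩ :=
    schedule_of_core (lam := lam) hθ0 (by linarith) hμ0 hδ₀.le hδ₁ hμδ hδlam N
  have hθw : 0 < 1 + θbar := by linarith
  have hlarge' : ∀ k, shellConst s (L : ℝ) (k₀ + 1) * (d * π ^ 2) *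
      ((1 + thetaSeq θbar μ δ₁ N k) * (1 * (4 / π ^ 2))⁻¹ + lam * (4 / π ^ 2)⁻¹) ^ 2 ≤
      μ * ((c / (L : ℝ) ^ (2 * (d + ñ) + 1)) / ((L : ℝ) ^ 2 * ((L : ℝ) ^ (d - 1 + n)) ^ (k₀ + 2))) :=
    fun k => hlarge _ (by linarith [hθlo k]) (hθhi2 k)
  have hseed0 : (1 / 2 + schedDelta δ₀ δ₁ N 0 * ∑ α ∈ s, ((4 : ℝ) * d) ^ (∑ i, α i - 1)) *
      (1 + thetaSeq θbar μ δ₁ N 0 + lam) ≤ 1 := by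
    rw [schedDelta_zero, thetaSeq_zero, ← hK]; exact hseed
  have hD := dominated_abkmWeightData (M := M) hR2 hL hd1 hMord (n := n) (ñ := ñ) (by omega) hc.le
    (le_max_right C 0) hshell hf_even hf_zero hinv hθw hlam hμ0 hθrec hθlo hθhi1 hδnn hδ4 hμδ' hδN
    hsmall hlarge' hseed0
  exact {
    eq := rfl
    dominated := hD
    theta_mem := fun k => ⟨hθlo k, hθhi2 k⟩
    monotone := monotone_abkmWeightData L N Mord R θbar hδnn _
    isLocal := local_abkmWeightData N hMord1 hMR hLM h3L θbar _ _
    additive := additive_abkmWeightData (hMord1.trans hMR) hL hM hθw.le _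
      (fun j hj1 hjN => heven j (mem_Icc.2 ⟨hj1, hjN⟩)) hnn hfr
    strong := fun s' hs' g hg => strongDominated_abkmWeightData L N R θbar hδnn _ hs' hg
    integral := fun k hk X hX φ =>
      integral_weight_abkm_le hd2 hMord1 hMR hLodd hL hθ0 hlam hθlo hnn hf_zero hf_even hD hk
        (heven (k + 1) (mem_Icc.2 ⟨by omega, hk⟩)) hn
        (Cα := fun θ' _ => Cα θ' 0) (fun θ' hθ' x => hreg (k + 1) (by omega) hk θ' hθ' x) hX φ
    zero_sum_even := ho'
    pos := fun j hj φ hφ => by rw [mem_Icc] at hj; exact hi j hj.1 hj.2 φ hφ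
    green := hii
    finiteRange := hfr
    regular := ⟨fun θ' => Cα θ' 0, hreg⟩
    multipliers_nonneg := hnn }

end Literature.MathematicalPhysics.StatisticalMechanics.GradientRG

end
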